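import Summits.PneNP.PneNP.Theses.PhaseTwins
import Literature.Computability.Complexity.HardcoreInapproximability
import Literature.Computability.Complexity.FPRASTransfer
import Literature.Computability.Complexity.FPStringBricks
import Literature.Computability.Complexity.StockmeyerMachines
import Literature.Computability.Complexity.OracleCompositionMachine
import Literature.Computability.Complexity.OracleProofs
import Literature.Computability.Complexity.OracleEmptyFP
import Literature.Computability.Complexity.StructuralPHProofs
import Literature.Barriers.PneNP.Relativization

/-!
# Negative lemmas for crux `NoFBPPApproxAboveUniqueness` (route PneNP/PhaseTwins, item stmt-PneNP-2717)

Calibration of the crux by its standing adversary (cdisprove gen 1): kernel-checked facts about what a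
DISPROOF of `Summit.PneNP.PneNP.Theses.PhaseTwins.NoFBPPApproxAboveUniqueness` is and would entail.
No theorem here concludes the crux positively; no definition is introduced.

* `hasFPRAS_of_padded` — the padding slot `1^{r|x|}` of `countQuery` is removable in `FP`: a padded
  FPRAS (the format of the crux's inner body) yields a `HasFPRAS` (`FPRAS.lean`); a brick-algebra
  construction inside the proof, no machine written.
* `crux_iff_inline` (`Iff.rfl`) — the route inlines `hardcoreCount` and `hardCoreThreshold` verbatim.
* `not_crux_iff` — `¬ crux ↔ ∀ Δ ≥ 3, q > 0, p/q > λ_c(Δ): HasFPRAS (hardcoreCount Δ p q)`: a disproof is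
  EXACTLY a family of FPRASes for the hard-core partition function above the tree-uniqueness threshold
  at every degree bound.
* `NP_eq_RP_of_not_crux` — modulo the vendored named fact `NP_eq_RP_of_hardcoreFPRAS`
  (Galanis–Štefankovič–Vigoda 2016, Thm 1) any disproof proves `NP = RP`.
* `crux_false_without_FP` — with `F ∈ FP` dropped the statement is false at every witness (exact
  counting as an unbounded transducer): the time bound is the only load-bearing hypothesis.
* `q_pos_of_threshold_lt` — the witness condition `0 < q` is implied by `3 ≤ Δ` and `λ_c(Δ) < p/q`.
* BARRIER REDUCTION: `relCrux_false_of_collapse` — the relativised crux (`FP ↦ FP^O`, inlined) fails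
  relative to every oracle with `NP^O ⊆ P^O`, given the route's routine support item `HardcoreCountSharpP`
  (proved Stockmeyer counter `stockmeyerApproxCounting_holds` at `O` + proved oracle composition);
  `not_relativizes_relCrux` — with the PROVED Baker–Gill–Solovay oracle, `HardcoreCountSharpP →` the crux
  does not relativise; `crux_iff_relCrux_empty` — the `O = ∅` instance is the crux (`FPRel_empty_eq`);
  `not_relCrux_of_not_crux` — `X^O → X` (contrapositive form): the barrier is one-sided, a disproof of X
  kills every relativised version.
-/

set_option linter.dupNamespace false

namespace Summit.PneNP.PneNP.Theorems.NoFBPPApproxAboveUniqueness.Negative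

open Literature.Computability.Complexity Literature.Probability.LatticeModels
open _root_.Computability Polynomial
open Summit.PneNP.PneNP.Theses.PhaseTwins (NoFBPPApproxAboveUniqueness HardcoreCountSharpP)
open Literature.Barriers.PneNP (Relativizes)

/-- **The padding slot is removable**: an `FP` transducer `F` answering the padded queries
`⟨x, 1^{r|x|}, 1^{kη}, 1^{kδ}, u⟩` with coins of length `c(|x| + r|x| + kη + kδ)` and failure `≤ 1/kδ`
(the inner body of the crux, for a general counting function `N`) yields `HasFPRAS N`. Brick algebra,
no machine written: on the canonical query `w = ⟨⟨x, ⟨1⁰, ⟨1^{kη}, 1^{kδ}⟩⟩⟩, U⟩` the transformer `T`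
rebuilds `⟨⟨x, ⟨1^{r|x|}, ⟨1^{kη}, 1^{kδ}⟩⟩⟩, U ↾ L⟩`, `L = c(|x| + r|x| + kη + kδ)`; the new transducer is
`F ∘ T` with coin budget `c ∘ (X + r)`, of which the prefix of length `L` is used
(`APTransfer.uniformProb_take_le_of_le`). [folklore] -/
theorem hasFPRAS_of_padded {N : List Bool → ℕ} {F : List Bool → List Bool} (hF : F ∈ FP)
    (c r : Polynomial ℕ)
    (hP : ∀ (x : List Bool) (kη kδ : ℕ), 0 < kη → 0 < kδ →
      uniformProb (c.eval (x.length + r.eval x.length + kη + kδ))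
        {u | ¬ IsApproxCount kη (N x) (countEstimate F x (r.eval x.length) kη kδ u)} ≤ 1 / (kδ : ℝ)) :
    HasFPRAS N := by
  -- the pieces of the transformer: `x`, `⟨1^{kη}, 1^{kδ}⟩`, `1^{r|x|}`, the ruler string, the cut coins
  set xF : List Bool → List Bool := Brick.fstF ∘ Brick.fstF with hxF
  set kkF : List Bool → List Bool := Brick.sndF ∘ Brick.sndF ∘ Brick.fstF with hkkF
  set mF : List Bool → List Bool := Plumb.polyFn r ∘ xF with hmF
  set sF : List Bool → List Bool :=
    fun w => (xF w ++ mF w) ++ (Brick.fstF (kkF w) ++ Brick.sndF (kkF w)) with hsF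
  set uF : List Bool → List Bool := Plumb.takeFn ∘ fanoutFn (Plumb.polyFn c ∘ sF) Brick.sndF with huF
  set T : List Bool → List Bool := fanoutFn (fanoutFn xF (fanoutFn mF kkF)) uF with hT
  -- `T ∈ FP`
  have hxFP : xF ∈ FP := comp_mem_FP Brick.fstF_mem_FP Brick.fstF_mem_FP
  have hkkFP : kkF ∈ FP :=
    comp_mem_FP Brick.sndF_mem_FP (comp_mem_FP Brick.sndF_mem_FP Brick.fstF_mem_FP)
  have hmFP : mF ∈ FP := comp_mem_FP (Plumb.polyFn_mem_FP r) hxFP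
  have hsFP : sF ∈ FP :=
    append_mem_FP (append_mem_FP hxFP hmFP)
      (append_mem_FP (comp_mem_FP Brick.fstF_mem_FP hkkFP) (comp_mem_FP Brick.sndF_mem_FP hkkFP))
  have huFP : uF ∈ FP :=
    comp_mem_FP Plumb.takeFn_mem_FP
      (fanoutFn_mem_FP (comp_mem_FP (Plumb.polyFn_mem_FP c) hsFP) Brick.sndF_mem_FP)
  have hTFP : T ∈ FP := fanoutFn_mem_FP (fanoutFn_mem_FP hxFP (fanoutFn_mem_FP hmFP hkkFP)) huFP
  -- semantics of `T` on canonical queries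
  have hTq : ∀ (x u : List Bool) (kη kδ : ℕ), T (countQuery x 0 kη kδ u) =
      countQuery x (r.eval x.length) kη kδ (u.take (c.eval (x.length + r.eval x.length + kη + kδ))) := by
    intro x u kη kδ
    have hx : xF (countQuery x 0 kη kδ u) = x := by
      simp [hxF, countQuery]
    have hkk : kkF (countQuery x 0 kη kδ u) = boolPair (unaryEncodeNat kη) (unaryEncodeNat kδ) := by
      simp [hkkF, countQuery]
    have hm : mF (countQuery x 0 kη kδ u) = unaryEncodeNat (r.eval x.length) := by
      simp [hmF, hx, APTransfer.ones_eq_unary]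
    have hs : (sF (countQuery x 0 kη kδ u)).length = x.length + r.eval x.length + kη + kδ := by
      simp [hsF, hx, hm, hkk, APTransfer.length_unary]
      omega
    have hsnd : Brick.sndF (countQuery x 0 kη kδ u) = u := by
      simp [countQuery]
    have hu : uF (countQuery x 0 kη kδ u) =
        u.take (c.eval (x.length + r.eval x.length + kη + kδ)) := by
      simp only [huF, Function.comp_apply, fanoutFn_apply, Plumb.polyFn_apply, hs, hsnd,
        Plumb.takeFn_boolPair, List.length_replicate]
    simp only [hT, fanoutFn_apply, hx, hm, hkk, hu]
    rfl
  -- the FPRAS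
  refine ⟨F ∘ T, comp_mem_FP hF hTFP, c.comp (X + r), fun x kη kδ hkη hkδ => ?_⟩
  set L := c.eval (x.length + r.eval x.length + kη + kδ) with hLdef
  have hL : L ≤ (c.comp (X + r)).eval (x.length + kη + kδ) := by
    simp only [eval_comp, eval_add, eval_X, hLdef]
    apply TM2Iter.eval_mono
    have := TM2Iter.eval_mono r (show x.length ≤ x.length + kη + kδ by omega)
    omega
  have key : {U | ¬ IsApproxCount kη (N x) (countEstimate (F ∘ T) x 0 kη kδ U)} =
      {U | U.take L ∈ {u | ¬ IsApproxCount kη (N x) (countEstimate F x (r.eval x.length) kη kδ u)}} := by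
    ext U
    simp only [Set.mem_setOf_eq, countEstimate_def, Function.comp_apply, hTq, hLdef]
  rw [key]
  exact APTransfer.uniformProb_take_le_of_le hL _ (hP x kη kδ hkη hkδ)

/-- The crux read back in tree vocabulary: the route inlines `hardcoreCount Δ p q` and
`hardCoreThreshold Δ` verbatim (`Iff.rfl`). [folklore] -/
theorem crux_iff_inline :
    NoFBPPApproxAboveUniqueness ↔
      ∃ Δ p q : ℕ, 3 ≤ Δ ∧ 0 < q ∧ hardCoreThreshold Δ < (p : ℝ) / q ∧
        ¬ ∃ F ∈ FP, ∃ c r : Polynomial ℕ, ∀ (x : List Bool) (kη kδ : ℕ), 0 < kη → 0 < kδ →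
          uniformProb (c.eval (x.length + r.eval x.length + kη + kδ))
            {u | ¬ IsApproxCount kη (hardcoreCount Δ p q x)
              (countEstimate F x (r.eval x.length) kη kδ u)} ≤ 1 / (kδ : ℝ) :=
  Iff.rfl

/-- **The negation of the crux, exactly**: FPRASes (`HasFPRAS`) for the hard-core counting function
`hardcoreCount Δ p q` above the uniqueness threshold at EVERY degree bound `Δ ≥ 3` and every rational
activity `p/q` (the padding slot is removed by `hasFPRAS_of_padded` and restored with `r = 0`). [folklore] -/
theorem not_crux_iff :
    ¬ NoFBPPApproxAboveUniqueness ↔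
      ∀ Δ p q : ℕ, 3 ≤ Δ → 0 < q → hardCoreThreshold Δ < (p : ℝ) / q → HasFPRAS (hardcoreCount Δ p q) := by
  rw [crux_iff_inline]
  constructor
  · intro h Δ p q hΔ hq hlam
    by_contra hno
    exact h ⟨Δ, p, q, hΔ, hq, hlam, fun ⟨F, hF, c, r, hP⟩ => hno (hasFPRAS_of_padded hF c r hP)⟩
  · rintro h ⟨Δ, p, q, hΔ, hq, hlam, hno⟩
    obtain ⟨F, hF, c, hc⟩ := h Δ p q hΔ hq hlam
    exact hno ⟨F, hF, c, 0, fun x kη kδ hkη hkδ => by simpa using hc x kη kδ hkη hkδ⟩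

/-- A family of FPRASes above the threshold refutes the crux (the direction a disprover would use).
[folklore] -/
theorem not_crux_of_hasFPRAS
    (h : ∀ Δ p q : ℕ, 3 ≤ Δ → 0 < q → hardCoreThreshold Δ < (p : ℝ) / q → HasFPRAS (hardcoreCount Δ p q)) :
    ¬ NoFBPPApproxAboveUniqueness :=
  not_crux_iff.2 h

/-- **Any disproof of the crux proves `NP = RP`**, modulo the vendored named fact
`NP_eq_RP_of_hardcoreFPRAS` (Galanis–Štefankovič–Vigoda 2016 Thm 1): instantiate the family of FPRASes at
`(Δ, λ) = (3, 5)`, `5 > λ_c(3) = 4`. [cite: GalanisStefankovicVigoda2016, Thm 1] -/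
theorem NP_eq_RP_of_not_crux (hGSV : NP_eq_RP_of_hardcoreFPRAS) (h : ¬ NoFBPPApproxAboveUniqueness) :
    Nondeterministic.NP = RP := by
  rw [not_crux_iff] at h
  refine hGSV 3 5 1 le_rfl one_pos ?_ (h 3 5 1 le_rfl one_pos ?_) <;>
  · rw [hardCoreThreshold_three]; norm_num

/-- **Any proof must use the time bound on `F`**: with `F ∈ FP` dropped (any transducer
`F : {0,1}* → {0,1}*`, otherwise the crux verbatim) the statement is false at EVERY witness — the exact
counter `⟨⟨x, …⟩, u⟩ ↦ ⟨N x⟩₂` never errs (`isApproxCount_self`), with no coins and no padding. [folklore] -/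
theorem crux_false_without_FP :
    ¬ ∃ Δ p q : ℕ, 3 ≤ Δ ∧ 0 < q ∧ hardCoreThreshold Δ < (p : ℝ) / q ∧
      ¬ ∃ F : List Bool → List Bool, ∃ c r : Polynomial ℕ, ∀ (x : List Bool) (kη kδ : ℕ), 0 < kη → 0 < kδ →
        uniformProb (c.eval (x.length + r.eval x.length + kη + kδ))
          {u | ¬ IsApproxCount kη (hardcoreCount Δ p q x) (countEstimate F x (r.eval x.length) kη kδ u)} ≤
            1 / (kδ : ℝ) := by
  rintro ⟨Δ, p, q, -, -, -, h⟩
  apply h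
  refine ⟨fun w => encodeNat (hardcoreCount Δ p q (boolUnpair (boolUnpair w).1).1), 0, 0,
    fun x kη kδ _ hkδ => ?_⟩
  have hval : ∀ u, countEstimate (fun w => encodeNat (hardcoreCount Δ p q (boolUnpair (boolUnpair w).1).1))
      x ((0 : Polynomial ℕ).eval x.length) kη kδ u = hardcoreCount Δ p q x := by
    intro u
    simp [countEstimate_def, countQuery, boolUnpair_boolPair, decode_encodeNat]
  have hempty : {u | ¬ IsApproxCount kη (hardcoreCount Δ p q x)
      (countEstimate (fun w => encodeNat (hardcoreCount Δ p q (boolUnpair (boolUnpair w).1).1))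
        x ((0 : Polynomial ℕ).eval x.length) kη kδ u)} = ∅ :=
    Set.eq_empty_iff_forall_notMem.2 fun u hu => hu (by rw [hval]; exact isApproxCount_self _ _)
  rw [hempty, uniformProb_empty]
  positivity

/-- **`0 < q` is redundant** among the witness conditions of the crux: for `Δ ≥ 3` the threshold is
positive (`hardCoreThreshold_pos`) and `(p : ℝ) / 0 = 0`. [folklore] -/
theorem q_pos_of_threshold_lt {Δ p q : ℕ} (hΔ : 3 ≤ Δ) (h : hardCoreThreshold Δ < (p : ℝ) / q) :
    0 < q := by
  rcases Nat.eq_zero_or_pos q with rfl | hq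
  · have := hardCoreThreshold_pos hΔ
    simp at h
    linarith
  · exact hq

/-! ### Barrier reduction: the crux does not relativise -/

/-- **Relative to a collapsing oracle the relativised crux fails** (`FP ↦ FP^O`, everything else the
crux verbatim in tree vocabulary), given `#P`-membership of `hardcoreCount` (the route's support item
`HardcoreCountSharpP`, stmt-PneNP-2722): Stockmeyer's counter (`stockmeyerApproxCounting_holds`, proved for
every oracle) for the witness relation `R ∈ P ⊆ P^O` lies in `FP^L`, `L ∈ NP^O ⊆ P^O`, hence in `FP^O`
(`ofLanguage_mem_FPRel_of_mem_PRel`, `FPRel_subset_FPRel_of_mem_FPRel`), and its guarantee at `m := r(|x|)`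
is the negated inner body. [cite: AaronsonArkhipovToC2013, Thm. 4.1] -/
theorem relCrux_false_of_collapse (hN : HardcoreCountSharpP) {O : Oracle} (hO : NPRel O ⊆ PRel O) :
    ¬ ∃ Δ p q : ℕ, 3 ≤ Δ ∧ 0 < q ∧ hardCoreThreshold Δ < (p : ℝ) / q ∧
      ¬ ∃ F ∈ FPRel O, ∃ c r : Polynomial ℕ, ∀ (x : List Bool) (kη kδ : ℕ), 0 < kη → 0 < kδ →
        uniformProb (c.eval (x.length + r.eval x.length + kη + kδ))
          {u | ¬ IsApproxCount kη (hardcoreCount Δ p q x) (countEstimate F x (r.eval x.length) kη kδ u)} ≤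
            1 / (kδ : ℝ) := by
  rintro ⟨Δ, p, q, -, -, -, h⟩
  obtain ⟨R, hR, rpoly, hcount⟩ := hN Δ p q
  obtain ⟨L, hL, F, hF, c, hc⟩ :=
    StockMachine.stockmeyerApproxCounting_holds O R (P_subset_PRel_holds O hR)
  have hFO : F ∈ FPRel O :=
    OracleAlg.FPRel_subset_FPRel_of_mem_FPRel (OracleAlg.ofLanguage_mem_FPRel_of_mem_PRel (hO hL)) hF
  refine h ⟨F, hFO, c, rpoly, fun x kη kδ hkη hkδ => ?_⟩
  have hx : hardcoreCount Δ p q x = countWitnesses R (rpoly.eval x.length) x := hcount x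
  rw [hx]
  exact hc x (rpoly.eval x.length) kη kδ hkη hkδ

/-- **The crux does not relativise** (modulo `HardcoreCountSharpP`): the statement `O ↦ X^O` fails at the
PROVED Baker–Gill–Solovay collapsing oracle (`baker_gill_solovay_eq_holds`), so no relativising argument
proves the crux (`Literature.Barriers.PneNP.Relativization`, formally, for this target).
[cite: BakerGillSolovay1975, main theorems (P^A = NP^A)] -/
theorem not_relativizes_relCrux (hN : HardcoreCountSharpP) :
    ¬ Relativizes fun O => ∃ Δ p q : ℕ, 3 ≤ Δ ∧ 0 < q ∧ hardCoreThreshold Δ < (p : ℝ) / q ∧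
      ¬ ∃ F ∈ FPRel O, ∃ c r : Polynomial ℕ, ∀ (x : List Bool) (kη kδ : ℕ), 0 < kη → 0 < kδ →
        uniformProb (c.eval (x.length + r.eval x.length + kη + kδ))
          {u | ¬ IsApproxCount kη (hardcoreCount Δ p q x) (countEstimate F x (r.eval x.length) kη kδ u)} ≤
            1 / (kδ : ℝ) := by
  obtain ⟨A, -, hA⟩ := baker_gill_solovay_eq_holds
  intro h
  exact relCrux_false_of_collapse hN (O := Oracle.ofLanguage A) hA.symm.le (h A)

/-- The `O = ∅` instance of the relativised crux is the crux (`FPRel_empty_eq : FP^∅ = FP`). [folklore] -/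
theorem crux_iff_relCrux_empty :
    NoFBPPApproxAboveUniqueness ↔ ∃ Δ p q : ℕ, 3 ≤ Δ ∧ 0 < q ∧ hardCoreThreshold Δ < (p : ℝ) / q ∧
      ¬ ∃ F ∈ FPRel Oracle.empty, ∃ c r : Polynomial ℕ, ∀ (x : List Bool) (kη kδ : ℕ), 0 < kη → 0 < kδ →
        uniformProb (c.eval (x.length + r.eval x.length + kη + kδ))
          {u | ¬ IsApproxCount kη (hardcoreCount Δ p q x) (countEstimate F x (r.eval x.length) kη kδ u)} ≤
            1 / (kδ : ℝ) := by
  rw [FPRel_empty_eq]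
  rfl

/-- **The relativised statements are stronger than the crux** (`FP ⊆ FP^O`): a disproof of the crux
disproves every relativised version, so the relativisation barrier is one-sided for this target (it
constrains proofs of X only). [folklore] -/
theorem not_relCrux_of_not_crux (h : ¬ NoFBPPApproxAboveUniqueness) (O : Oracle) :
    ¬ ∃ Δ p q : ℕ, 3 ≤ Δ ∧ 0 < q ∧ hardCoreThreshold Δ < (p : ℝ) / q ∧
      ¬ ∃ F ∈ FPRel O, ∃ c r : Polynomial ℕ, ∀ (x : List Bool) (kη kδ : ℕ), 0 < kη → 0 < kδ →
        uniformProb (c.eval (x.length + r.eval x.length + kη + kδ))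
          {u | ¬ IsApproxCount kη (hardcoreCount Δ p q x) (countEstimate F x (r.eval x.length) kη kδ u)} ≤
            1 / (kδ : ℝ) := by
  rintro ⟨Δ, p, q, hΔ, hq, hlam, hno⟩
  exact h ⟨Δ, p, q, hΔ, hq, hlam, fun ⟨F, hF, c, r, hP⟩ =>
    hno ⟨F, OracleAlg.FP_subset_FPRel_core O hF, c, r, hP⟩⟩

end Summit.PneNP.PneNP.Theorems.NoFBPPApproxAboveUniqueness.Negative
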